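import Summits.Ventures.PercRepro.S1SevenFiveSeparators

/-!
# PercRepro — THE TRIANGLE SUMMAND AT `(9, 6)` BY RECURSION ON THE `(7, 5)` CAPSTONE (p2, gen 28; SUBCLAIM-S1
§6.10 (xvii)(n))

A `(9, 6)` core `M` (rank `9` on `15` points) with a triangle separator `C` is `M ↾ (E ∖ C) ⊕ C` with the first
part of rank `7` on `12` points — a `(7, 5)` core; `rls_nine_four_of_triangle_separator_of_rls` asks for the
`(7, 4)` body of that part, which `rls_seven_four_of_separator` supplies whenever the part is itself
`1`-separable. So a `(9, 6)` core with a triangle summand satisfies the `(9, 4)` body unless its other part is a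
CONNECTED `(7, 5)` core. Nothing is claimed about any cell.

* `rls_nine_four_of_triangle_separator_of_separator`.
Axioms: standard.
-/

open scoped Matroid

namespace PercRepro

namespace S1

open Set

variable {α : Type}

/-- **`(9, 4)` for a coloop-free simple matroid of rank `9` on `15` points with a triangle separator `C` whose
other part is `1`-separable**: the `(7, 4)` body of `M ↾ (E ∖ C)` comes from the `(7, 5)` capstone. -/
theorem rls_nine_four_of_triangle_separator_of_separator (M : Matroid α) [M.Finite] {C : Set α}
    (hC : M.IsCircuit C) (hsep : M.eRk (M.E \ C) + M.eRk C = M.eRank) (hC3 : C.ncard = 3)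
    (hM : M.eRank = ((9 : ℕ) : ℕ∞)) (hE : M.E.ncard = 15) (hcol : M.coloops = ∅)
    (hpairs : ∀ e ∈ M.E, ∀ f ∈ M.E, e ≠ f → M.eRk {e, f} = 2) {A : Set α} (hA : A ⊆ M.E \ C)
    (hne : A.Nonempty) (hne' : ((M.E \ C) \ A).Nonempty)
    (hsepA : M.eRk A + M.eRk ((M.E \ C) \ A) = M.eRk (M.E \ C)) : ThmN.RLS M 9 4 := by
  have hB : M.E \ C ⊆ M.E := sdiff_subset
  haveI hBfin : (M ↾ (M.E \ C)).Finite := Matroid.restrict_finite (M.ground_finite.subset hB)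
  apply rls_nine_four_of_triangle_separator_of_rls M hC hsep hC3 hM
  -- the part has rank `7` on `12` points
  obtain ⟨r, hr, hrs⟩ := circuit_separator_ranks M hC hsep (p := 9) (s := 2) hM hC3
  have hr7 : (M ↾ (M.E \ C)).eRank = ((7 : ℕ) : ℕ∞) := by rw [hr]; congr 1; omega
  have hBE : (M ↾ (M.E \ C)).E.ncard = 12 := by
    rw [Matroid.restrict_ground_eq, ncard_sdiff' hC.subset_ground M.ground_finite, hE, hC3]
  have hcolB := restrict_compl_coloops_eq_empty_of_circuit_separator M hC hsep hcol
  -- the separator `A` of the part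
  have hA' : A ⊆ (M ↾ (M.E \ C)).E := by rw [Matroid.restrict_ground_eq]; exact hA
  have hne'' : ((M ↾ (M.E \ C)).E \ A).Nonempty := by rw [Matroid.restrict_ground_eq]; exact hne'
  have hsepA' : (M ↾ (M.E \ C)).eRk A + (M ↾ (M.E \ C)).eRk ((M ↾ (M.E \ C)).E \ A) = (M ↾ (M.E \ C)).eRank := by
    rw [Matroid.restrict_ground_eq, Matroid.eRank_restrict, M.restrict_eRk_eq hA, M.restrict_eRk_eq sdiff_subset]
    exact hsepA
  exact rls_seven_four_of_separator (M ↾ (M.E \ C)) hA' hne hne'' hsepA' (restrict_pairs_of_pairs M hpairs hB)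
    hr7 hBE hcolB

end S1

end PercRepro
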